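import Mathlib
import Summits.Ventures.PercRepro2.IncReimerProof
import Summits.Ventures.PercRepro2.StepPattern

/-!
# (INC-BK): the pattern BK slacks `T(a,b) − T(0,a+b)` are monotone in the split set
(seat mine-b, cell pub-perc-repro2; conjectures/MINE-B.md §13 Addendum 8)

For any event `A` the packing events `A_k = kDisj A k` are increasing and a disjoint
occurrence of `A_b` and `A_a` is exactly `a + b` disjoint witnesses (`kDisj_add_dOcc`, `dOcc_kDisj_add`).
So the pattern BK slack `T(a,b) − T(0,a+b)` (non-negative by `absT_zero_add_le`) is the Reimer slack
of the pair `(A_b, A_a)` (`reimerSlack_kDisj_eq`), and (INC-REIMER) makes it monotone in the split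
set: `absT_bk_slack_mono`.  For `a = 1` these are the `a = 1` rows of the BAL family: the slack of
`T(1,b) ≥ T(0,b+1)` never decreases when an element joins the split set.
-/

open Finset

namespace Summit.Ventures.PercRepro2

namespace StepZero

open ReimerCube

variable {E : Type*} [DecidableEq E]

open Classical

/-- disjoint witnesses of `a` and of `b` disjoint occurrences give `a + b` disjoint witnesses -/
lemma dOcc_kDisj_add (A : Finset E → Prop) :
    ∀ (a b : ℕ) {S : Finset E}, DOcc (kDisj A a) (kDisj A b) S → kDisj A (a + b) S
  | 0, b, S, h => by
      obtain ⟨-, L, -, hL, -, -, hB⟩ := h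
      rw [Nat.zero_add]
      exact hB S hL
  | a + 1, b, S, h => by
      obtain ⟨K, L, hK, hL, hKL, hA, hB⟩ := h
      obtain ⟨K₁, K', hK₁, hK', hd, hA₁, hA'⟩ := hA K le_rfl
      have e : a + 1 + b = a + b + 1 := by omega
      rw [e]
      refine ⟨K₁, K' ∪ L, hK₁.trans hK, Finset.union_subset (hK'.trans hK) hL, ?_, hA₁, ?_⟩
      · exact Finset.disjoint_union_right.2 ⟨hd, Finset.disjoint_of_subset_left hK₁ hKL⟩
      · intro T hT
        apply dOcc_kDisj_add A a b
        exact ⟨K', L, Finset.subset_union_left.trans hT, Finset.subset_union_right.trans hT,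
          Finset.disjoint_of_subset_left hK' hKL, hA', hB⟩

/-- the pattern BK slack `T(a,b) − T(0,a+b)` is the Reimer slack of the pair `(A_b, A_a)` -/
lemma reimerSlack_kDisj_eq (A : Finset E → Prop) (O Y : Finset E) (a b : ℕ) :
    reimerSlack (kDisj A b) (kDisj A a) O Y = (absT A O Y a b : ℤ) - absT A O Y 0 (a + b) := by
  unfold reimerSlack absT pinK
  have h1 : (Y.powerset.filter (fun γ => kDisj A b (O ∪ γ) ∧ kDisj A a (O ∪ (Y \ γ)))).card
      = (Y.powerset.filter (fun γ => kDisj A a (O ∪ (Y \ γ)) ∧ kDisj A b (O ∪ γ))).card := by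
    congr 1
    ext γ
    rw [Finset.mem_filter, Finset.mem_filter]
    apply and_congr_right
    intro _
    exact and_comm
  have h2 : (Y.powerset.filter (fun γ => DOcc (kDisj A b) (kDisj A a) (O ∪ γ))).card
      = (Y.powerset.filter (fun γ => kDisj A 0 (O ∪ (Y \ γ)) ∧ kDisj A (a + b) (O ∪ γ))).card := by
    congr 1
    ext γ
    rw [Finset.mem_filter, Finset.mem_filter]
    apply and_congr_right
    intro _
    constructor
    · intro h
      refine ⟨trivial, ?_⟩
      rw [Nat.add_comm]
      exact dOcc_kDisj_add A b a h
    · rintro ⟨-, h⟩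
      rw [Nat.add_comm] at h
      exact kDisj_add_dOcc A b a h
  rw [h1, h2]

/-- **(INC-BK)**: for every increasing event and all `a, b`, the pattern BK slack `T(a,b) − T(0,a+b)`
never decreases when an element joins the split set. -/
theorem absT_bk_slack_mono (A : Finset E → Prop) (O Y : Finset E) (q : E)
    (hqO : q ∉ O) (hqY : q ∉ Y) (a b : ℕ) :
    (absT A O Y a b : ℤ) - absT A O Y 0 (a + b)
      ≤ (absT A O (insert q Y) a b : ℤ) - absT A O (insert q Y) 0 (a + b) := by
  rw [← reimerSlack_kDisj_eq, ← reimerSlack_kDisj_eq]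
  exact incReimer_of_incr (incr_kDisj A b) (incr_kDisj A a) O Y q hqO hqY

end StepZero

end Summit.Ventures.PercRepro2
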